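import Summits.QuantumAdvantage.QuantumAdvantage.Theorems.CubicForrelationNearExactIsExactTwelveWildParity

/-!
# Crux `CubicForrelation.NearExactIsExact` (stmt-QuantumAdvantage-14043) — MINIMUM-WEIGHT SETS WITH EVEN FLAT SECTIONS ARE FLATS
  (the even-section form of "minimum-weight Reed–Muller codewords are flats")

Certificate seat `b2b-cforr-cert` (gen 23).  HONEST FRAMING: a classical coding-theory lemma in the combinatorial form needed by the finite-slice
analyses of the crux (the 256-point set of configuration (c) of a level-5 side at `Φ = 29/32` on 12 bits is an 8-flat).  NOT summit progress.

`emf_flat_of_even_sections`: let `S ∋ 0` be `⊕`-closed with `#S = 2^m`, `T = c ⊕ S` a coset, and `A ⊆ T` a set meeting every parametrised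
`(r+2)`-flat `b ⊕ ⟨a₀,…,a_{r+1}⟩` (`b ∈ T`, `aᵢ ∈ S`) in an EVEN number of parameters, with `2^{r+1}·#A = 2^m` (the minimum size allowed by
the Reed–Muller distance `erm_weight_ge`).  Then the periods `V₀ = {a ∈ S : A ⊕ a = A}` contain `0`, are `⊕`-closed, `#V₀ = #A`, and
`A = x₀ ⊕ V₀` for every `x₀ ∈ A`: `A` is a flat.  Proof (the double counting of `mw_flat_of_minweight` with degrees replaced by sections): for
`a ∈ S` the symmetric difference `A △ (A ⊕ a)` has even sections on parametrised `(r+1)`-flats (a `(r+2)`-flat with first direction `a`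
splits into an `(r+1)`-flat and its translate by `a`), so by `erm_weight_ge` it is empty or has `≥ 2^{m−r} = 2·#A` points, while it has
`2(#A − #(A ∩ (A ⊕ a)))` points: each `a ∈ S` is a period or moves `A` off itself; and `Σ_{a∈S} #(A ∩ (A ⊕ a)) = #A²` counts `#V₀·#A`.

References: F. J. MacWilliams, N. J. A. Sloane, *The Theory of Error-Correcting Codes* (1977), Ch. 13 §4; C. Carlet (2021) §4.1.  Axioms:
the standard three.
-/

set_option linter.dupNamespace false -- D-0017: single-problem summit ⇒ `QuantumAdvantage.QuantumAdvantage` by design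

noncomputable section

namespace Summit.QuantumAdvantage.QuantumAdvantage.Theorems.CubicForrelation.NearExactIsExact

open Finset
open Literature.Computability.QuantumComplexity
open Literature.Computability.QuantumComplexity.BuzetChailloux (bxor zeroVec bxor_bxor_cancel_left bxor_zeroVec zeroVec_bxor bxor_comm
  bxor_self)

variable {n : ℕ}

/-- Two points of a coset `c ⊕ S` of an `⊕`-closed `S` differ by an element of `S`. [folklore] -/
theorem emf_coset_diff (S : Finset (Fin n → Bool)) (hadd : ∀ a ∈ S, ∀ b ∈ S, bxor a b ∈ S) (c : Fin n → Bool)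
    {x y : Fin n → Bool} (hx : x ∈ S.image (bxor c)) (hy : y ∈ S.image (bxor c)) : bxor x y ∈ S := by
  obtain ⟨v, hv, rfl⟩ := mem_image.1 hx
  obtain ⟨w, hw, rfl⟩ := mem_image.1 hy
  have e : bxor (bxor c v) (bxor c w) = bxor v w := by
    funext j; simp only [bxor]; cases c j <;> cases v j <;> cases w j <;> rfl
  rw [e]; exact hadd v hv w hw

/-- For `x` in the coset `T = c ⊕ S` and `A ⊆ T`: `#{a ∈ S : x ⊕ a ∈ A} = #A`. [folklore] -/
theorem emf_card_translates (S : Finset (Fin n → Bool)) (hadd : ∀ a ∈ S, ∀ b ∈ S, bxor a b ∈ S) (c : Fin n → Bool)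
    (A : Finset (Fin n → Bool)) (hA : A ⊆ S.image (bxor c)) {x : Fin n → Bool} (hx : x ∈ S.image (bxor c)) :
    #(S.filter fun a => bxor x a ∈ A) = #A := by
  refine card_nbij' (fun a => bxor x a) (fun y => bxor x y) (fun a ha => ?_) (fun y hy => ?_)
    (fun a _ => bxor_bxor_cancel_left x a) (fun y _ => bxor_bxor_cancel_left x y)
  · rw [mem_coe, mem_filter] at ha; exact ha.2
  · rw [mem_coe] at hy
    rw [mem_coe, mem_filter]
    refine ⟨emf_coset_diff S hadd c hx (hA hy), ?_⟩
    rw [bxor_bxor_cancel_left]; exact hy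

/-- **Minimum-weight sets with even flat sections are flats** (even-section form of "minimum-weight words of `RM(r+1, m)` are
`(m−r−1)`-flats").  See the module docstring. [cite: MacWilliamsSloane1977, Ch. 13 §4] -/
theorem emf_flat_of_even_sections (m r : ℕ) (S : Finset (Fin n → Bool)) (h0 : zeroVec ∈ S)
    (hadd : ∀ a ∈ S, ∀ b ∈ S, bxor a b ∈ S) (hcard : #S = 2 ^ m) (c : Fin n → Bool)
    (A : Finset (Fin n → Bool)) (hA : A ⊆ S.image (bxor c))
    (heven : ∀ b ∈ S.image (bxor c), ∀ a : Fin (r + 1 + 1) → Fin n → Bool, (∀ i, a i ∈ S) →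
      Even #(univ.filter fun ε : Fin (r + 1 + 1) → Bool => (fun j => b j ^^ decide (Odd #(univ.filter fun i => ε i && a i j))) ∈ A))
    (hcardA : 2 ^ (r + 1) * #A = 2 ^ m) :
    zeroVec ∈ S.filter (fun a => ∀ x ∈ A, bxor x a ∈ A) ∧
    (∀ a ∈ S.filter (fun a => ∀ x ∈ A, bxor x a ∈ A), ∀ b ∈ S.filter (fun a => ∀ x ∈ A, bxor x a ∈ A),
      bxor a b ∈ S.filter (fun a => ∀ x ∈ A, bxor x a ∈ A)) ∧
    #(S.filter fun a => ∀ x ∈ A, bxor x a ∈ A) = #A ∧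
    ∀ x₀ ∈ A, A = (S.filter fun a => ∀ x ∈ A, bxor x a ∈ A).image (bxor x₀) := by
  classical
  set V₀ := S.filter (fun a => ∀ x ∈ A, bxor x a ∈ A) with hV₀
  -- Step 1: every `a ∈ S` is a period of `A` or moves `A` off itself
  have hdich : ∀ a ∈ S, (∀ x ∈ A, bxor x a ∈ A) ∨ #(A.filter fun x => bxor x a ∈ A) = 0 := by
    intro a ha
    by_cases hper : ∀ x ∈ A, bxor x a ∈ A
    · exact Or.inl hper
    right
    push Not at hper
    obtain ⟨x₁, hx₁A, hx₁⟩ := hper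
    -- `h = 1_A ⊕ 1_{A ⊕ a}` has even sections on parametrised `(r+1)`-flats of the coset
    set h : (Fin n → Bool) → Bool := fun x => decide (x ∈ A) ^^ decide (bxor x a ∈ A) with hh
    have H : ∀ b ∈ S.image (bxor c), ∀ a' : Fin (r + 1) → Fin n → Bool, (∀ i, a' i ∈ S) →
        Even #(univ.filter fun ε : Fin (r + 1) → Bool => h (fun j => b j ^^ decide (Odd #(univ.filter fun i => ε i && a' i j))) = true) := by
      intro b hb a' ha'
      have hdirs : ∀ i, (Fin.cons a a' : Fin (r + 1 + 1) → Fin n → Bool) i ∈ S := fun i => by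
        refine Fin.cases ?_ (fun i => ?_) i
        · simpa using ha
        · simpa using ha' i
      have hsplit := heven b hb (Fin.cons a a') hdirs
      rw [erm_card_split] at hsplit
      have e0 : ∀ ε : Fin (r + 1) → Bool, (fun j => b j ^^ decide (Odd #(univ.filter fun i : Fin (r + 1 + 1) => (Fin.cons false ε : Fin (r + 1 + 1) → Bool) i && (Fin.cons a a' : Fin (r + 1 + 1) → Fin n → Bool) i j))) = (fun j => b j ^^ decide (Odd #(univ.filter fun i => ε i && a' i j))) := by
        intro ε; rw [erm_flatPt_cons]; funext j; simp only [Bool.false_and, Bool.xor_false]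
      have e1 : ∀ ε : Fin (r + 1) → Bool, (fun j => b j ^^ decide (Odd #(univ.filter fun i : Fin (r + 1 + 1) => (Fin.cons true ε : Fin (r + 1 + 1) → Bool) i && (Fin.cons a a' : Fin (r + 1 + 1) → Fin n → Bool) i j))) = bxor (fun j => b j ^^ decide (Odd #(univ.filter fun i => ε i && a' i j))) a := by
        intro ε; rw [erm_flatPt_cons]; funext j; simp only [Bool.true_and, bxor]
      have c0 : #(univ.filter fun ε : Fin (r + 1) → Bool => (fun j => b j ^^ decide (Odd #(univ.filter fun i : Fin (r + 1 + 1) => (Fin.cons false ε : Fin (r + 1 + 1) → Bool) i && (Fin.cons a a' : Fin (r + 1 + 1) → Fin n → Bool) i j))) ∈ A) =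
          #(univ.filter fun ε : Fin (r + 1) → Bool => decide ((fun j => b j ^^ decide (Odd #(univ.filter fun i => ε i && a' i j))) ∈ A) = true) :=
        congrArg card (filter_congr fun ε _ => by rw [e0 ε, decide_eq_true_iff])
      have c1 : #(univ.filter fun ε : Fin (r + 1) → Bool => (fun j => b j ^^ decide (Odd #(univ.filter fun i : Fin (r + 1 + 1) => (Fin.cons true ε : Fin (r + 1 + 1) → Bool) i && (Fin.cons a a' : Fin (r + 1 + 1) → Fin n → Bool) i j))) ∈ A) =
          #(univ.filter fun ε : Fin (r + 1) → Bool => decide (bxor (fun j => b j ^^ decide (Odd #(univ.filter fun i => ε i && a' i j))) a ∈ A) = true) :=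
        congrArg card (filter_congr fun ε _ => by rw [e1 ε, decide_eq_true_iff])
      rw [c0, c1] at hsplit
      exact erm_even_card_xor (fun ε : Fin (r + 1) → Bool => decide ((fun j => b j ^^ decide (Odd #(univ.filter fun i => ε i && a' i j))) ∈ A))
        (fun ε => decide (bxor (fun j => b j ^^ decide (Odd #(univ.filter fun i => ε i && a' i j))) a ∈ A)) hsplit
    have hex : ∃ x ∈ S.image (bxor c), h x = true := by
      refine ⟨x₁, hA hx₁A, ?_⟩
      simp only [h, decide_eq_true hx₁A, decide_eq_false hx₁]; rfl
    have hge := erm_weight_ge m r S h0 hadd hcard c h H hex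
    -- upper bound: `#{h = 1} ≤ 2(#A − #(A ∩ (A ⊕ a)))`
    have hcancel : ∀ x : Fin n → Bool, bxor (bxor x a) a = x := fun x => by
      rw [iw_bxor_assoc, bxor_self, bxor_zeroVec]
    have hsub : (S.image (bxor c)).filter (fun x => h x = true) ⊆
        (A.filter fun x => bxor x a ∉ A) ∪ (A.filter fun x => bxor x a ∉ A).image (fun x => bxor x a) := by
      intro x hx
      have hx2 := (mem_filter.1 hx).2
      rw [mem_union, mem_filter, mem_image]
      by_cases hxA : x ∈ A
      · left
        refine ⟨hxA, fun h' => ?_⟩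
        simp only [h, decide_eq_true hxA, decide_eq_true h'] at hx2
        exact Bool.noConfusion hx2
      · right
        have hxa : bxor x a ∈ A := by
          by_contra h'
          simp only [h, decide_eq_false hxA, decide_eq_false h'] at hx2
          exact Bool.noConfusion hx2
        refine ⟨bxor x a, mem_filter.2 ⟨hxa, ?_⟩, hcancel x⟩
        rw [hcancel]; exact hxA
    have hcomp : #(A.filter fun x => bxor x a ∉ A) + #(A.filter fun x => bxor x a ∈ A) = #A := by
      rw [add_comm]; exact card_filter_add_card_filter_not _
    have hub : #((S.image (bxor c)).filter fun x => h x = true) ≤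
        2 * (#A - #(A.filter fun x => bxor x a ∈ A)) := by
      calc #((S.image (bxor c)).filter fun x => h x = true)
          ≤ #((A.filter fun x => bxor x a ∉ A) ∪ (A.filter fun x => bxor x a ∉ A).image (fun x => bxor x a)) :=
            card_le_card hsub
        _ ≤ #(A.filter fun x => bxor x a ∉ A) + #((A.filter fun x => bxor x a ∉ A).image (fun x => bxor x a)) :=
            card_union_le _ _
        _ ≤ #(A.filter fun x => bxor x a ∉ A) + #(A.filter fun x => bxor x a ∉ A) := by
            exact Nat.add_le_add_left card_image_le _
        _ = 2 * (#A - #(A.filter fun x => bxor x a ∈ A)) := by omega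
    -- combine with `2^m ≤ 2^r · #{h = 1}` and `2^{r+1}·#A = 2^m`
    have hle' : 2 ^ r * 2 * #A ≤ 2 ^ r * 2 * (#A - #(A.filter fun x => bxor x a ∈ A)) := by
      have h1 : 2 ^ r * 2 * #A = 2 ^ m := by rw [← pow_succ]; exact hcardA
      rw [h1]
      calc 2 ^ m ≤ 2 ^ r * #((S.image (bxor c)).filter fun x => h x = true) := hge
        _ ≤ 2 ^ r * (2 * (#A - #(A.filter fun x => bxor x a ∈ A))) := Nat.mul_le_mul_left _ hub
        _ = 2 ^ r * 2 * (#A - #(A.filter fun x => bxor x a ∈ A)) := by ring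
    have hle'' := Nat.le_of_mul_le_mul_left hle' (by positivity)
    have hI_le : #(A.filter fun x => bxor x a ∈ A) ≤ #A := card_filter_le _ _
    omega
  -- Step 2: double counting `Σ_{a ∈ S} #(A ∩ (A ⊕ a)) = #A²`
  have hcount : ∑ a ∈ S, #(A.filter fun x => bxor x a ∈ A) = #A * #A := by
    calc ∑ a ∈ S, #(A.filter fun x => bxor x a ∈ A)
        = ∑ a ∈ S, ∑ x ∈ A, (if bxor x a ∈ A then 1 else 0) := sum_congr rfl fun a _ => card_filter _ _
      _ = ∑ x ∈ A, ∑ a ∈ S, (if bxor x a ∈ A then 1 else 0) := sum_comm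
      _ = ∑ x ∈ A, #(S.filter fun a => bxor x a ∈ A) := sum_congr rfl fun x _ => (card_filter _ _).symm
      _ = ∑ x ∈ A, #A := sum_congr rfl fun x hx => emf_card_translates S hadd c A hA (hA hx)
      _ = #A * #A := by rw [sum_const, smul_eq_mul]
  -- Step 3: the same sum counts `#V₀ · #A`
  have hcount2 : ∑ a ∈ S, #(A.filter fun x => bxor x a ∈ A) = #V₀ * #A := by
    rw [← sum_filter_add_sum_filter_not S (fun a => ∀ x ∈ A, bxor x a ∈ A)]
    have h1 : ∑ a ∈ S.filter (fun a => ∀ x ∈ A, bxor x a ∈ A), #(A.filter fun x => bxor x a ∈ A) = ∑ a ∈ V₀, #A :=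
      sum_congr rfl fun a ha => by rw [filter_eq_self.2 (fun x hx => (mem_filter.1 ha).2 x hx)]
    have h2 : ∑ a ∈ S.filter (fun a => ¬ ∀ x ∈ A, bxor x a ∈ A), #(A.filter fun x => bxor x a ∈ A) = 0 :=
      sum_eq_zero fun a ha => by
        have ha' := mem_filter.1 ha
        rcases hdich a ha'.1 with h | h
        · exact absurd h ha'.2
        · exact h
    rw [h1, h2, add_zero, sum_const, smul_eq_mul]
  have hApos : 0 < #A := by
    refine Nat.pos_of_ne_zero fun hz => ?_
    rw [hz, mul_zero] at hcardA
    exact absurd hcardA (by positivity)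
  have hV₀card : #V₀ = #A := Nat.eq_of_mul_eq_mul_right hApos (hcount2.symm.trans hcount)
  -- conclusions
  refine ⟨?_, ?_, hV₀card, ?_⟩
  · exact mem_filter.2 ⟨h0, fun x hx => by rw [bxor_zeroVec]; exact hx⟩
  · intro a ha b hb
    rw [mem_filter] at ha hb ⊢
    exact ⟨hadd a ha.1 b hb.1, fun x hx => by rw [← iw_bxor_assoc]; exact hb.2 _ (ha.2 x hx)⟩
  · intro x₀ hx₀
    refine (eq_of_subset_of_card_le (fun y hy => ?_) ?_).symm
    · obtain ⟨v, hv, rfl⟩ := mem_image.1 hy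
      exact (mem_filter.1 hv).2 x₀ hx₀
    · rw [card_image_of_injective _ (fun y y' hyy => by
        have h' := congrArg (bxor x₀) hyy
        rwa [bxor_bxor_cancel_left, bxor_bxor_cancel_left] at h'), hV₀card]

end Summit.QuantumAdvantage.QuantumAdvantage.Theorems.CubicForrelation.NearExactIsExact

end
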